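import Literature.AlgebraicGeometry.HodgeTheory.VHSDataNonGenericHodgeClassesFinite
import Literature.AlgebraicGeometry.HodgeTheory.VHSDataComapCharts
import Literature.AlgebraicGeometry.HodgeTheory.VHSDataHodgeLocusOverCompactCurve
import Literature.AlgebraicGeometry.HodgeTheory.VHSDataProdCharts
import HarnessLib

/-!
# The non-generic Hodge locus seen from a covering, under isometric isomorphisms, for the tensor constructions and over a complete curve

Topic `Literature/AlgebraicGeometry/HodgeTheory` (namespace `Literature.AlgebraicGeometry.Motives.VHSData[.IsLocallyFlatCharted]`), lane `lit-hodgefound`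
(seat `p08`, row g60-#9).  THEOREMS ONLY — no definition, no named fact, no instance (D-0026 net debt `0`).  Sequel of
`VHSDataNonGenericHodgeClassesFinite` (`nonGenericHodgeLocus D p K`: the points carrying an integral class of type `(p,p)` with `Q(u,u) ≤ K` admitting NO
determination of type `(p,p)` at some point; it is FINITE for a locally flat-charted variation over a curve), combined with `Motives/FamiliesVHSComap[Covering]`
(pull-backs, path lifting), `Motives/FamiliesVHSIso` (isometric isomorphisms), `VHSDataComapCharts` (interior charts on the sheets of a covering),
`VHSDataLocallyFlatCharted` ∕ `VHSDataProdCharts` (closure of flat charts under `T^{a,b}`, `Hom`, `∨`, `⊕`) and `VHSDataHodgeLocusOverCompactCurve`.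

PRINTED SOURCE, VERBATIM (E. Cattani, P. Deligne, A. Kaplan, *On the locus of Hodge classes*, J. AMS 8 (1995); held text `paper:arxiv-alg-geom_9402009`
p0001–p0002).  P. 484: «**Theorem 1.1.** `S^{(K)}` is an algebraic variety, finite over `S`.» (for an ARBITRARY polarized variation — the tensor
constructions included); «**Corollary 1.3.** … The set of points in `S` where some determination of `u` is of type `(0,0)`, is an algebraic subvariety
of `S`. *Proof*: Such set is a union of images of connected components of `S^{(K)}`»; p. 485: «To prove 1.1 one is free to replace `S` of 1.1 by a
finite etale covering `S′ → S`.»  P. Deligne, *Équations différentielles à points singuliers réguliers*, LNM 163 (1970), I.1 (`(f^*𝒱)_{s′} = 𝒱_{f(s′)}`,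
transports along `γ′` and `f ∘ γ′` agree).

* §1 **`nonGenericHodgeLocus_subset_image_comap`** — for `f : S′ → S` continuous SURJECTIVE, `E(D) ⊆ f(E(f^*D))`: a class non-generic for `D` at
  `f(s′)` is non-generic for `f^*D` at `s′` (a determination upstairs pushes forward to one downstairs, `determinationLocus_comap_subset`); hence
  **`finite_nonGenericHodgeLocus_of_comap`**: finiteness DESCENDS along any continuous surjection.  Conversely, for `f` a COVERING MAP and `f^*D`
  locally flat-charted upstairs, `f(E(f^*D)) ⊆ E(D)` (`image_nonGenericHodgeLocus_comap_subset`: a non-generic class upstairs has a FINITE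
  determination locus by Cor. 1.3 upstairs, whose image — the determination locus downstairs, by path lifting — is finite, and `S` is infinite), so
  **`image_nonGenericHodgeLocus_comap_eq`**.
* §2 «replace `S` by a finite etale covering»: **`finite_nonGenericHodgeLocus_of_comap_of_isLocallyFlatCharted`** (flat charts of `f^*D` upstairs),
  `…_of_compactification`, and **`finite_nonGenericHodgeLocus_of_sheets`** (flat interior charts of `D` DOWNSTAIRS and flat puncture charts of `f^*D`
  UPSTAIRS only, `IsLocallyFlatCharted.comap_of_sheets`).
* §3 **`Iso.nonGenericHodgeLocus_eq`** — invariance under ISOMETRIC isomorphisms of VHS data.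
* §4 the TENSOR CONSTRUCTIONS from flat charts of `D` (resp. `D₁`, `D₂`) alone: `IsLocallyFlatCharted.finite_nonGenericHodgeLocus_tensorSpace ∕ _hom ∕
  _dual ∕ _prod`.
* §5 over a COMPLETE curve (`S` compact, no ends): `IsLocallyFlatCharted.finite_nonGenericHodgeLocus_of_compactSpace`.

HONEST SCOPE: `dim = 1` for §2, §4, §5; charts are hypotheses; the analytic structure of `S^{(K)}` is not formalized (see the sibling file).

## References

* [CattaniDeligneKaplan1995] E. Cattani, P. Deligne, A. Kaplan, *On the locus of Hodge classes*, J. Amer. Math. Soc. 8 (1995) 483–506: §1, Thm. 1.1,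
  Cor. 1.3 (p. 484), «Proof of 1.5 ⟹ 1.1» (p. 485), 2.3 (p. 487), (2.4) (p. 488).
* [Deligne1970] P. Deligne, *Équations différentielles à points singuliers réguliers*, LNM 163 (1970), I.1.
* [Schmid1973] W. Schmid, *Variation of Hodge structure: the singularities of the period mapping*, Invent. Math. 22 (1973), §2 (cite only).
* [FritzscheGrauert2002] K. Fritzsche, H. Grauert, *From Holomorphic Functions to Complex Manifolds*, GTM 213 (2002), Ch. I §8, Ch. IV §1 (cite only).
-/

noncomputable section

open scoped TensorProduct ComplexOrder
open _root_.Topology _root_.Filter Set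

universe u

namespace Literature.AlgebraicGeometry

open Motives Motives.HodgeStructure HodgeTheory Topology

namespace Motives.VHSData

variable {S : Type} [TopologicalSpace S] {S' : Type} [TopologicalSpace S'] {k : ℤ} (D : VHSData S k) (f : C(S', S))

/-! ## §1 The non-generic locus seen from a covering space -/

/-- **`E(D) ⊆ f(E(f^*D))` for `f` surjective**: a class `u ∈ V_ℤ,f(s′) = (f^*V_ℤ)_{s′}` of type `(p,p)` with `Q(u,u) ≤ K` whose determination locus
for `D` is not all of `S` has determination locus for `f^*D` not all of `S′` (determinations upstairs push forward: `f(Y′) ⊆ Y`, and `f(S′) = S`).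
[cite: CattaniDeligneKaplan1995, §1, Cor. 1.3 (p. 484), «Proof of 1.5 ⟹ 1.1» (p. 485)] [cite: Deligne1970, I.1] -/
theorem nonGenericHodgeLocus_subset_image_comap (hf : Function.Surjective f) (p K : ℤ) :
    D.nonGenericHodgeLocus p K ⊆ f '' (D.comap f).nonGenericHodgeLocus p K := by
  rintro s ⟨u, hu, hK, hne⟩
  obtain ⟨s', rfl⟩ := hf s
  refine ⟨s', ⟨u, (D.isHodgeAt_comap_iff f s' p u).2 hu, by rwa [comap_form, comap_toRat], fun huniv => hne ?_⟩, rfl⟩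
  refine eq_univ_of_univ_subset ?_
  rw [← hf.range_eq, ← image_univ, ← huniv]
  exact image_subset_iff.2 (D.determinationLocus_comap_subset f p s' u)

/-- **Finiteness of the non-generic locus DESCENDS along a continuous surjection.** [cite: CattaniDeligneKaplan1995, «Proof of 1.5 ⟹ 1.1» (p. 485)] -/
theorem finite_nonGenericHodgeLocus_of_comap (hf : Function.Surjective f) {p K : ℤ} (h : ((D.comap f).nonGenericHodgeLocus p K).Finite) :
    (D.nonGenericHodgeLocus p K).Finite :=
  (h.image f).subset (D.nonGenericHodgeLocus_subset_image_comap f hf p K)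

/-- Over a base `S′` covered by charts into `ℂ`, the image of a local homeomorphism `f : S′ → S` — in particular `S` if `f` is onto — is infinite.
[cite: FritzscheGrauert2002, Ch. IV §1] -/
theorem infinite_univ_of_isLocalHomeomorph_of_charts {α' : Type*} (ψ' : α' → OpenPartialHomeomorph S' ℂ) (hcov' : ∀ x' : S', ∃ a, x' ∈ (ψ' a).source)
    {g : S' → S} (hg : IsLocalHomeomorph g) [Nonempty S'] : (univ : Set S).Infinite := by
  obtain ⟨x'⟩ := ‹Nonempty S'›
  obtain ⟨e, hxe, hge⟩ := hg x'
  obtain ⟨a, hxa⟩ := hcov' x'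
  have hO : (e.source ∩ (ψ' a).source).Infinite :=
    infinite_of_isOpen_of_mem_source (ψ' a) (e.open_source.inter (ψ' a).open_source) ⟨hxe, hxa⟩ hxa
  exact (hO.image (e.injOn.mono inter_subset_left)).mono (subset_univ _)

variable {α' ι' : Type*} {ψ' : α' → OpenPartialHomeomorph S' ℂ} {σ' : ι' → ℂ → S'}

/-- **`f(E(f^*D)) ⊆ E(D)` for a COVERING MAP `f` and `f^*D` locally flat-charted upstairs** (`S′` preconnected, discs covering `S′`, open ends, compact
core, continuous ends): a class non-generic upstairs has a FINITE determination locus for `f^*D` (Cor. 1.3 upstairs: everything or finite); its image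
under `f` is the determination locus for `D` (path lifting, `image_determinationLocus_comap`), finite, hence not all of the infinite `S`.
[cite: CattaniDeligneKaplan1995, Cor. 1.3 (p. 484), «Proof of 1.5 ⟹ 1.1» (p. 485)] [cite: Deligne1970, I.1] -/
theorem image_nonGenericHodgeLocus_comap_subset [PreconnectedSpace S'] (hf : IsCoveringMap f) (h' : (D.comap f).IsLocallyFlatCharted ψ' σ')
    {p : ℤ} (hpk : p + p = k) (K : ℤ) (hcov' : ∀ x' : S', ∃ a, x' ∈ (ψ' a).source) (A' : ι' → ℝ)
    (hopen' : ∀ (i : ι') (A'' : ℝ), A' i ≤ A'' → IsOpen (σ' i '' {z : ℂ | A'' < z.im}))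
    (hcore' : ∀ A'' : ι' → ℝ, (∀ i, A' i ≤ A'' i) → ∃ K₀ : Set S', IsCompact K₀ ∧ K₀ ∪ ⋃ i, σ' i '' {z : ℂ | A'' i < z.im} = univ)
    (hcont' : ∀ i, ContinuousOn (σ' i) {z : ℂ | A' i < z.im}) :
    f '' (D.comap f).nonGenericHodgeLocus p K ⊆ D.nonGenericHodgeLocus p K := by
  rintro _ ⟨s', ⟨u, hu, hK, hne⟩, rfl⟩
  haveI : Nonempty S' := ⟨s'⟩
  have hSinf : (univ : Set S).Infinite := infinite_univ_of_isLocalHomeomorph_of_charts ψ' hcov' hf.isLocalHomeomorph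
  have hfin : {t' : S' | ∃ γ' : Path.Homotopic.Quotient s' t', (D.comap f).IsHodgeAt t' p ((D.comap f).VZ.transport γ' u)}.Finite :=
    (h'.determinationLocus_eq_univ_or_finite hpk u hcov' A' hopen' hcore' hcont').resolve_left hne
  refine ⟨u, (D.isHodgeAt_comap_iff f s' p u).1 hu, by rwa [comap_form, comap_toRat] at hK, fun huniv => hSinf ?_⟩
  rw [← huniv, ← D.image_determinationLocus_comap hf p s' u]
  exact hfin.image f

/-- **THE NON-GENERIC LOCUS SEEN FROM A COVERING SPACE: `E(D) = f(E(f^*D))`** for a surjective covering map `f` with `f^*D` locally flat-charted upstairs.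
[cite: CattaniDeligneKaplan1995, §1, Cor. 1.3 (p. 484), «Proof of 1.5 ⟹ 1.1» (p. 485)] [cite: Deligne1970, I.1] -/
theorem image_nonGenericHodgeLocus_comap_eq [PreconnectedSpace S'] (hf : IsCoveringMap f) (hsurj : Function.Surjective f)
    (h' : (D.comap f).IsLocallyFlatCharted ψ' σ') {p : ℤ} (hpk : p + p = k) (K : ℤ) (hcov' : ∀ x' : S', ∃ a, x' ∈ (ψ' a).source) (A' : ι' → ℝ)
    (hopen' : ∀ (i : ι') (A'' : ℝ), A' i ≤ A'' → IsOpen (σ' i '' {z : ℂ | A'' < z.im}))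
    (hcore' : ∀ A'' : ι' → ℝ, (∀ i, A' i ≤ A'' i) → ∃ K₀ : Set S', IsCompact K₀ ∧ K₀ ∪ ⋃ i, σ' i '' {z : ℂ | A'' i < z.im} = univ)
    (hcont' : ∀ i, ContinuousOn (σ' i) {z : ℂ | A' i < z.im}) :
    f '' (D.comap f).nonGenericHodgeLocus p K = D.nonGenericHodgeLocus p K :=
  Subset.antisymm (D.image_nonGenericHodgeLocus_comap_subset f hf h' hpk K hcov' A' hopen' hcore' hcont')
    (D.nonGenericHodgeLocus_subset_image_comap f hsurj p K)

/-! ## §2 «Replace `S` by a finite etale covering»: finiteness from charts upstairs -/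

/-- **ALL BUT FINITELY MANY BOUNDED HODGE CLASSES OF `D` ARE GENERIC, FROM FLAT CHARTS OF `f^*D` ON A COVER `S′ → S`**: `f` continuous SURJECTIVE (the
finite étale cover of the printed proof), `S′` preconnected, `f^*D` locally flat-charted by discs `ψ′ a` covering `S′` and ends `σ′ i` (open ends,
compact core, continuous end maps); then `E(D) = nonGenericHodgeLocus D p K` is FINITE. [cite: CattaniDeligneKaplan1995, §1, Thm. 1.1, Cor. 1.3 (p. 484),
«Proof of 1.5 ⟹ 1.1» (p. 485)] -/
theorem finite_nonGenericHodgeLocus_of_comap_of_isLocallyFlatCharted [PreconnectedSpace S'] (hsurj : Function.Surjective f)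
    (h' : (D.comap f).IsLocallyFlatCharted ψ' σ') {p : ℤ} (hpk : p + p = k) (K : ℤ) (hcov' : ∀ x' : S', ∃ a, x' ∈ (ψ' a).source) (A' : ι' → ℝ)
    (hopen' : ∀ (i : ι') (A'' : ℝ), A' i ≤ A'' → IsOpen (σ' i '' {z : ℂ | A'' < z.im}))
    (hcore' : ∀ A'' : ι' → ℝ, (∀ i, A' i ≤ A'' i) → ∃ K₀ : Set S', IsCompact K₀ ∧ K₀ ∪ ⋃ i, σ' i '' {z : ℂ | A'' i < z.im} = univ)
    (hcont' : ∀ i, ContinuousOn (σ' i) {z : ℂ | A' i < z.im}) :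
    (D.nonGenericHodgeLocus p K).Finite :=
  D.finite_nonGenericHodgeLocus_of_comap f hsurj (h'.finite_nonGenericHodgeLocus hpk K hcov' A' hopen' hcore' hcont')

variable {X' : Type*} [TopologicalSpace X'] [CompactSpace X']

/-- **The same with the ends of `S′` read off a compactification `j′ : S′ ↪ X′`.** [cite: CattaniDeligneKaplan1995, Thm. 1.1, Cor. 1.3 (p. 484),
«Proof of 1.5 ⟹ 1.1» (p. 485), 2.3 (p. 487)] -/
theorem finite_nonGenericHodgeLocus_of_comap_of_isLocallyFlatCharted_of_compactification [PreconnectedSpace S'] (hsurj : Function.Surjective f)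
    (h' : (D.comap f).IsLocallyFlatCharted ψ' σ') {p : ℤ} (hpk : p + p = k) (K : ℤ) (hcov' : ∀ x' : S', ∃ a, x' ∈ (ψ' a).source) (A' : ι' → ℝ)
    {j' : S' → X'} (hj' : IsEmbedding j') (pt : ι' → X') (hpS : ∀ i, pt i ∉ range j') (hcovX : ∀ x : X', x ∉ range j' → ∃ i, x = pt i)
    (φ' : ι' → OpenPartialHomeomorph X' ℂ) (hp : ∀ i, pt i ∈ (φ' i).source) (hφp : ∀ i, φ' i (pt i) = 0)
    (hball : ∀ i, Metric.ball (0 : ℂ) (Real.exp (-(2 * Real.pi * A' i))) ⊆ (φ' i).target)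
    (hσ : ∀ (i : ι') (z : ℂ), A' i < z.im → j' (σ' i z) = (φ' i).symm (Complex.exp (2 * Real.pi * Complex.I * z))) :
    (D.nonGenericHodgeLocus p K).Finite :=
  D.finite_nonGenericHodgeLocus_of_comap f hsurj
    (h'.finite_nonGenericHodgeLocus_of_compactification hpk K hcov' A' hj' pt hpS hcovX φ' hp hφp hball hσ)

/-- **ALL BUT FINITELY MANY BOUNDED HODGE CLASSES OF `D` ARE GENERIC, FROM FLAT INTERIOR CHARTS OF `D` DOWNSTAIRS AND FLAT PUNCTURE CHARTS OF `f^*D`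
UPSTAIRS** (sheets `e_b` of `f` covering `S′`, discs `ψ_a` covering `S`; the interior charts of `f^*D` on the charts `ψ_a ∘ e_b` are induced:
`IsLocallyFlatCharted.comap_of_sheets`). [cite: CattaniDeligneKaplan1995, §1, Thm. 1.1, Cor. 1.3 (p. 484), «Proof of 1.5 ⟹ 1.1» (p. 485), (2.4) (p. 488)]
[cite: FritzscheGrauert2002, Ch. IV §1] -/
theorem finite_nonGenericHodgeLocus_of_sheets [PreconnectedSpace S'] {α β : Type*} (ψ : α → OpenPartialHomeomorph S ℂ)
    (E : β → OpenPartialHomeomorph S' S) (hE : ∀ b x, E b x = f x) (hsurj : Function.Surjective f)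
    (hcov : ∀ y : S, ∃ a, y ∈ (ψ a).source) (hcov' : ∀ x : S', ∃ b, x ∈ (E b).source)
    (hint : ∀ a, ∀ y ∈ (ψ a).source, ∃ r > 0, Metric.ball (ψ a y) r ⊆ (ψ a).target ∧
      ∃ (V : Type) (_ : AddCommGroup V) (_ : Module ℚ V) (_ : FiniteDimensional ℚ V) (H₀ : HodgeStructure V k) (P₀ : H₀.Polarization)
        (C : D.InteriorChart (restrBall (ψ a) y r) P₀), C.IsFlat)
    (hpunct : ∀ i, ∃ (V : Type) (_ : AddCommGroup V) (_ : Module ℚ V) (_ : FiniteDimensional ℚ V) (L : PolarizedLimitMixedHodgeStructure V k)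
      (C : (D.comap f).PunctureChart (σ' i) L), C.IsFlat)
    {p : ℤ} (hpk : p + p = k) (K : ℤ) (A' : ι' → ℝ) (hopen' : ∀ (i : ι') (A'' : ℝ), A' i ≤ A'' → IsOpen (σ' i '' {z : ℂ | A'' < z.im}))
    (hcore' : ∀ A'' : ι' → ℝ, (∀ i, A' i ≤ A'' i) → ∃ K₀ : Set S', IsCompact K₀ ∧ K₀ ∪ ⋃ i, σ' i '' {z : ℂ | A'' i < z.im} = univ)
    (hcont' : ∀ i, ContinuousOn (σ' i) {z : ℂ | A' i < z.im}) :
    (D.nonGenericHodgeLocus p K).Finite :=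
  D.finite_nonGenericHodgeLocus_of_comap f hsurj
    ((IsLocallyFlatCharted.comap_of_sheets f ψ E hE hint hpunct).finite_nonGenericHodgeLocus hpk K
      (exists_mem_sheetChart_source ψ E hE hcov hcov') A' hopen' hcore' hcont')

/-! ## §3 Invariance under isometric isomorphisms -/

variable {D}

/-- **The non-generic locus is invariant under ISOMETRIC isomorphisms of VHS data** (`hom` preserves Hodge classes, `Q` and the determination loci).
[cite: CattaniDeligneKaplan1995, §1 (p. 484)] [cite: Schmid1973, §2] -/
theorem Iso.nonGenericHodgeLocus_subset {D₁ D₂ : VHSData S k} (e : Iso D₁ D₂) (he : e.hom.IsIsometry) (p K : ℤ) :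
    D₁.nonGenericHodgeLocus p K ⊆ D₂.nonGenericHodgeLocus p K := by
  rintro s ⟨u, hu, hK, hne⟩
  refine ⟨e.hom.app s u, (e.isHodgeAt_hom_app_iff s p u).2 hu, by rw [he.form_toRat_app]; exact hK, ?_⟩
  rw [e.setOf_exists_isHodgeAt_transport_eq s p u]
  exact hne

/-- **`E(D₁) = E(D₂)` for an isometric isomorphism `D₁ ≅ D₂`.** [cite: CattaniDeligneKaplan1995, §1 (p. 484)] [cite: Schmid1973, §2] -/
theorem Iso.nonGenericHodgeLocus_eq {D₁ D₂ : VHSData S k} (e : Iso D₁ D₂) (he : e.hom.IsIsometry) (p K : ℤ) :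
    D₁.nonGenericHodgeLocus p K = D₂.nonGenericHodgeLocus p K :=
  Subset.antisymm (e.nonGenericHodgeLocus_subset he p K) (e.symm.nonGenericHodgeLocus_subset (e.isIsometry_inv he) p K)

/-! ## §4 The tensor constructions, from flat charts of `D` alone -/

namespace IsLocallyFlatCharted

variable {α ι : Type*} {ψ : α → OpenPartialHomeomorph S ℂ} {σ : ι → ℂ → S} {k₁ k₂ : ℤ}

/-- **FOR `T^{a,b}D` FROM FLAT CHARTS OF `D`** (Theorem 1.1 is stated for an arbitrary polarized variation; flat charts pass to `T^{a,b}`: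
`IsLocallyFlatCharted.tensorSpace`): the non-generic locus of `T^{a,b}D` at level `p + p = a·k − b·k` is finite.
[cite: CattaniDeligneKaplan1995, §1, Thm. 1.1, Cor. 1.3 (p. 484)] -/
theorem finite_nonGenericHodgeLocus_tensorSpace [PreconnectedSpace S] (h : D.IsLocallyFlatCharted ψ σ) (a b : ℕ) {p : ℤ}
    (hpk : p + p = (a : ℤ) * k + (b : ℤ) * (-k)) (K : ℤ) (hcov : ∀ x : S, ∃ a, x ∈ (ψ a).source) (A : ι → ℝ)
    (hopen : ∀ (i : ι) (A' : ℝ), A i ≤ A' → IsOpen (σ i '' {z : ℂ | A' < z.im}))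
    (hcore : ∀ A' : ι → ℝ, (∀ i, A i ≤ A' i) → ∃ K₀ : Set S, IsCompact K₀ ∧ K₀ ∪ ⋃ i, σ i '' {z : ℂ | A' i < z.im} = univ)
    (hcont : ∀ i, ContinuousOn (σ i) {z : ℂ | A i < z.im}) :
    ((D.tensorSpace a b).nonGenericHodgeLocus p K).Finite :=
  (h.tensorSpace a b).finite_nonGenericHodgeLocus hpk K hcov A hopen hcore hcont

/-- **FOR `Hom(D₁, D₂)` FROM FLAT CHARTS OF `D₁`, `D₂`** (level `p + p = k₂ − k₁`; `p = 0` for equal weights: the morphism classes).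
[cite: CattaniDeligneKaplan1995, §1, Thm. 1.1, Cor. 1.3 (p. 484)] -/
theorem finite_nonGenericHodgeLocus_hom [PreconnectedSpace S] {D₁ : VHSData S k₁} {D₂ : VHSData S k₂} (h₁ : D₁.IsLocallyFlatCharted ψ σ)
    (h₂ : D₂.IsLocallyFlatCharted ψ σ) {p : ℤ} (hpk : p + p = k₂ - k₁) (K : ℤ) (hcov : ∀ x : S, ∃ a, x ∈ (ψ a).source) (A : ι → ℝ)
    (hopen : ∀ (i : ι) (A' : ℝ), A i ≤ A' → IsOpen (σ i '' {z : ℂ | A' < z.im}))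
    (hcore : ∀ A' : ι → ℝ, (∀ i, A i ≤ A' i) → ∃ K₀ : Set S, IsCompact K₀ ∧ K₀ ∪ ⋃ i, σ i '' {z : ℂ | A' i < z.im} = univ)
    (hcont : ∀ i, ContinuousOn (σ i) {z : ℂ | A i < z.im}) :
    ((D₁.hom D₂).nonGenericHodgeLocus p K).Finite :=
  (h₁.hom h₂).finite_nonGenericHodgeLocus hpk K hcov A hopen hcore hcont

/-- **FOR THE DUAL `D^∨` FROM FLAT CHARTS OF `D`** (level `p + p = −k`). [cite: CattaniDeligneKaplan1995, §1, Thm. 1.1, Cor. 1.3 (p. 484)] -/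
theorem finite_nonGenericHodgeLocus_dual [PreconnectedSpace S] (h : D.IsLocallyFlatCharted ψ σ) {p : ℤ} (hpk : p + p = -k) (K : ℤ)
    (hcov : ∀ x : S, ∃ a, x ∈ (ψ a).source) (A : ι → ℝ) (hopen : ∀ (i : ι) (A' : ℝ), A i ≤ A' → IsOpen (σ i '' {z : ℂ | A' < z.im}))
    (hcore : ∀ A' : ι → ℝ, (∀ i, A i ≤ A' i) → ∃ K₀ : Set S, IsCompact K₀ ∧ K₀ ∪ ⋃ i, σ i '' {z : ℂ | A' i < z.im} = univ)
    (hcont : ∀ i, ContinuousOn (σ i) {z : ℂ | A i < z.im}) :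
    (D.dual.nonGenericHodgeLocus p K).Finite :=
  h.dual.finite_nonGenericHodgeLocus hpk K hcov A hopen hcore hcont

/-- **FOR THE DIRECT SUM `D₁ ⊕ D₂` FROM FLAT CHARTS OF THE SUMMANDS** (`IsLocallyFlatCharted.prod`).
[cite: CattaniDeligneKaplan1995, §1, Thm. 1.1, Cor. 1.3 (p. 484)] -/
theorem finite_nonGenericHodgeLocus_prod [PreconnectedSpace S] {D₁ D₂ : VHSData S k} (h₁ : D₁.IsLocallyFlatCharted ψ σ)
    (h₂ : D₂.IsLocallyFlatCharted ψ σ) {p : ℤ} (hpk : p + p = k) (K : ℤ) (hcov : ∀ x : S, ∃ a, x ∈ (ψ a).source) (A : ι → ℝ)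
    (hopen : ∀ (i : ι) (A' : ℝ), A i ≤ A' → IsOpen (σ i '' {z : ℂ | A' < z.im}))
    (hcore : ∀ A' : ι → ℝ, (∀ i, A i ≤ A' i) → ∃ K₀ : Set S, IsCompact K₀ ∧ K₀ ∪ ⋃ i, σ i '' {z : ℂ | A' i < z.im} = univ)
    (hcont : ∀ i, ContinuousOn (σ i) {z : ℂ | A i < z.im}) :
    ((D₁.prod D₂).nonGenericHodgeLocus p K).Finite :=
  (h₁.prod h₂).finite_nonGenericHodgeLocus hpk K hcov A hopen hcore hcont

/-! ## §5 Over a complete curve -/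

/-- **OVER A COMPLETE CURVE** (`S` compact, preconnected, covered by the discs; no ends, `IsEmpty ι`): the non-generic locus of a locally flat-charted
`D` is finite. [cite: CattaniDeligneKaplan1995, §1, Thm. 1.1, Cor. 1.3 (p. 484)] [cite: FritzscheGrauert2002, Ch. I §8] -/
theorem finite_nonGenericHodgeLocus_of_compactSpace [CompactSpace S] [PreconnectedSpace S] [IsEmpty ι] (h : D.IsLocallyFlatCharted ψ σ) {p : ℤ}
    (hpk : p + p = k) (K : ℤ) (hcov : ∀ x : S, ∃ a, x ∈ (ψ a).source) : (D.nonGenericHodgeLocus p K).Finite :=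
  h.finite_nonGenericHodgeLocus hpk K hcov (fun i => isEmptyElim i) (fun i => isEmptyElim i)
    (fun A' _ => exists_isCompact_core_of_compactSpace A') fun i => isEmptyElim i

end IsLocallyFlatCharted

end Motives.VHSData

end Literature.AlgebraicGeometry

end
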